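import Literature.Geometry.Kaehler.ComplexTorusAbelianDivisorClassAnyDim
import Literature.Geometry.Kaehler.ComplexTorusSubtorusDegree
import HarnessLib

/-!
# Auffarth's Theorem 1.1 / 2.10 ON THE NOSE in every dimension: abelian divisors ↔ primitive classes
# `α ∈ NS(X)` with `α² = 0` and `deg α = (α · Θ^{n-1}) > 0`

Layer `Literature/Geometry/Kaehler`, namespace `Literature.Geometry.Kaehler.ComplexTorus`; lane `lit-hodgefound`
(Track 2 foundations library, Layer A4 "cycle classes on abelian varieties"), seat `lit-hodgefound-skel-4`, row A4-61
FILE 5 (rider). Sequel of `ComplexTorusAbelianDivisorClass` (FILE 1: `[Y]` is primitive, `Y ↦ [Y]` injective),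
`ComplexTorusEllipticCurveDegree` (FILE 2: the sign `deg > 0` for `g = 2`), `ComplexTorusAbelianDivisorClassAnyDim`
(FILE 3: Theorem 2.10 UP TO SIGN in every dimension) and of p36's `ComplexTorusSubtorusDegree` (the degree
`(L^d · Y) = ∫_X c₁(L)^{∧d} ∧ cl(Y)` of an abelian subvariety and its positivity for polarisations), all consumed BY NAME.

## Source followed, verbatim

R. Auffarth, *Elliptic curves on abelian varieties*, Illinois J. Math. **59** (2015) 271–279, arXiv:1507.08617
(held `paper:arxiv-1507.08617`, `pNNNN Lk` = chunk / line of the held text):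

* p0003 L21–L22: "**Theorem 1.1.** Let `A` be an abelian variety of dimension `n`, and let `Θ` be a fixed ample divisor
  on `A`. Then the map `Z ↦ [Z]` induces a bijective correspondence between abelian divisors on `A` and primitive
  elements `α ∈ NS(A)` that satisfy `α² = 0` in `𝔄^*(A)` and `(α · Θ^{n-1}) > 0`."
* p0006 L13–L14: "We define the degree of a divisor `D` on `A` to be `deg D := (D · Θ^{n-1})`. In the same way we define
  the degree of an algebraic class."
* p0006 L21–L24: "**Theorem 2.10.** Let `A` be an abelian variety of dimension `n`. Then the map `Z ↦ [Z]` induces a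
  bijective correspondence between abelian divisors on `A` and primitive elements `α ∈ NS(A)` that satisfy `α² = 0` in
  `𝔄^*(A)` and `deg α > 0`. *Proof.* Injectivity was already proven. To show surjectivity, let `α` be a primitive class
  that satisfies `(α · Θ^{n-1}) > 0` and `α² = 0`. […] Proposition (4) says that `α` is numerically equivalent to (the
  class of) an effective divisor, and Corollary (7) says that `α` actually comes from an abelian divisor."

## Dictionary (TORUS level, invariant forms) and what is proved

`X = E/Φ(ℤ^ι)` is a complex torus of dimension `n = d + 1` (`e : Fin (2d + 2) ≃ ι`); an ABELIAN DIVISOR is a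
codimension-one complex subtorus `Y = π(ΦW)` (`W ⊆ Λ ⊗ ℝ` a complex lattice subspace of rank `rk(Λ ∩ W) = 2d`;
`IsLatticeSubspace`, `IsComplexSubspace`); its class is `[Y] = (SubtorusFrame.ofSubspace Φ W hW hWc eY hpos).cycleForm e ∈
H²(X, ℤ)` (rows A4-18 / Q672: the positively oriented adapted frame `λ′ ∘ eY`; the class does not depend on the chosen
positively oriented `eY`, `cycleForm_ofSubspace_eq_of_orientationSign_eq_one`); `NS(X) ∩` "integral" is
`integralHodgeClasses Φ 1 = H²(X, ℤ) ∩ H^{1,1}`; "primitive" is Def. 2.3 in `H²(X, ℤ) = integralForms Φ 2`; `α² = 0` is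
`α ∧ α = 0`; the ample `Θ` is a Riemann form `η₀` (`IsRiemannForm Φ η₀`, `c₁(Θ) = -η₀`) and
**`deg α = (α · Θ^{n-1}) = ∫_X c₁(Θ)^{∧d} ∧ α = torusIntegral Φ e ((wedgePow (ofRealForm (-η₀)) d).wedge α)`**
(p36's de Jong degree, `ComplexTorusSubtorusDegree`).

* §1 **the degree of an abelian divisor is positive**: `cycleForm_ofSubspace_degree_pos` (`deg [Y] > 0` in the
  ordered field `ℂ`), `cycleForm_ofSubspace_degree_re_pos`, `cycleForm_ofSubspace_exists_pos_degree_eq_factorial_mul`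
  (`deg [Y] = d! · m`, `m ≥ 1`: Riemann–Roch on `Y`), and `torusIntegral_wedgePow_wedge_neg_cycleForm_re_neg`
  (`deg (-[Y]) < 0`) — p36's `SubtorusFrame.degree_pos_of_isRiemannForm` on the datum of `W`.
* §2 **Theorem 2.10 / 1.1, surjectivity ON THE NOSE in every dimension**:
  `exists_cycleForm_eq_of_primitive_of_wedge_self_eq_zero_of_degree_pos` — a primitive `γ ∈ H²(X, ℤ) ∩ H^{1,1}` with
  `γ ∧ γ = 0` and `deg γ > 0` IS the class `[Y]` of an abelian divisor (FILE 3 gives `γ = ±[Y]`; §1 excludes `-[Y]`).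
* §3 **the bijection**: `cycleForm_ofSubspace_eq_of_orientationSign_eq_one` (the class depends only on `Y`),
  `cycleForm_ofSubspace_mem_primitive_wedge_degree` (for every abelian divisor `Y`: `[Y]` is an integral Hodge class,
  primitive, of square zero and of positive degree — the map `Z ↦ [Z]` lands in the printed set), injectivity BY NAME
  (FILE 1 `eq_of_cycleForm_ofSubspace_eq`, not restated), and
  **`existsUnique_abelianDivisor_of_primitive_of_wedge_self_eq_zero_of_degree_pos`** (`∃! W`: Theorem 1.1 as a
  bijective correspondence, every dimension `n ≥ 1`), `exists_abelianDivisor_subRank_eq_…` (`rk(Λ ∩ W) = 2(n-1)`, `W ≠ Λ ⊗ ℝ`).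

Everything is a theorem; no definition, no named fact. The printed route (Nakai–Moishezon, Prop. 2.5, `K(D)`) is
replaced — as in FILES 1–3 — by the linear algebra of the rank-two form `[Y] = p^*vol_{X/Y}`; the sign is the
positivity of the degree of an abelian subvariety (the necessity half of Nakai's criterion, de Jong Thm. 4.3.1, =
Lange's Lemma 2.2.2 (a)(ii) on `Y`), which is where `Θ` enters.

## References

* [Auffarth2015EllipticCurvesAbelianVarieties] R. Auffarth, *Elliptic curves on abelian varieties*, Illinois J. Math.
  59 (2015) 271–279; arXiv:1507.08617 — Thm. 1.1 (p0003), Def. 2.3, Lemma 2.7 (p0005), "deg D", Cor. 2.9, Thm. 2.10 (p0006).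
* [Kani1994EllipticCurvesAbelianSurfaces] E. Kani, *Elliptic curves on abelian surfaces*, Manuscripta Math. 84 (1994)
  199–223 (the case `n = 2`).
* [deJong1993AmpleLineBundles] A. J. de Jong, *Ample line bundles and intersection theory*, LNM 1566 (1993), Ch. VII §4
  (Def. 4.2 `(L₁ ⋯ L_d · Z)`, "deg_L Z", Thm. 4.3.1).
* [Lange2023AbelianVarietiesComplex] H. Lange, *Abelian Varieties over the Complex Numbers* (2023), §2.2.1 Lemma 2.2.2
  (a)(ii), §1.5.4 (1.22), §6.2.1.
-/

noncomputable section

set_option maxSynthPendingDepth 3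

open scoped ComplexOrder
open Module Function Complex

namespace Literature.Geometry.Kaehler

namespace ComplexTorus

/-! ## §0 Two small identities on forms -/

section Helpers

variable {E : Type*} [NormedAddCommGroup E] [NormedSpace ℂ E] {k l : ℕ}

/-- `α ∧ (-β) = -(α ∧ β)` (bilinearity of `∧`). [cite: Lange2023AbelianVarietiesComplex, §1.3.3 Lemma 1.3.6 (proof)] -/
private theorem wedge_neg_right' (α : E [⋀^Fin k]→L[ℝ] ℂ) (β : E [⋀^Fin l]→L[ℝ] ℂ) :
    α.wedge (-β) = -(α.wedge β) := by
  rw [eq_neg_iff_add_eq_zero, ← ContinuousAlternatingMap.wedge_add_right, neg_add_cancel,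
    ContinuousAlternatingMap.wedge_zero]

variable {ι : Type*} [DecidableEq ι] (Φ : (ι → ℝ) ≃L[ℝ] E) {N : ℕ}

/-- `∫_X (-θ) = -∫_X θ`. [cite: Lange2023AbelianVarietiesComplex, §6.2.4 (p. 310)] -/
private theorem torusIntegral_neg'' (e : Fin N ≃ ι) (θ : E [⋀^Fin N]→L[ℝ] ℂ) :
    torusIntegral Φ e (-θ) = -torusIntegral Φ e θ := by
  rw [← neg_one_smul ℂ θ, torusIntegral_smul, neg_one_mul]

end Helpers

/-! ## §1 The degree `deg [Y] = ([Y] · Θ^{n-1})` of an abelian divisor is positive -/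

section Degree

variable {ι : Type*} [Fintype ι] [DecidableEq ι] {E : Type*} [NormedAddCommGroup E] [NormedSpace ℂ E]
  (Φ : (ι → ℝ) ≃L[ℝ] E) (W : Submodule ℝ (ι → ℝ)) (hW : IsLatticeSubspace W) (hWc : IsComplexSubspace Φ W)
  {d : ℕ} (eY : Fin (2 * d) ≃ Fin (subRank W)) (hpos : orientationSign (subtorusPeriod Φ W hW hWc) eY = 1)
  (e : Fin (2 * d + 2) ≃ ι)

/-- **`deg [Y] = ([Y] · Θ^{n-1}) > 0` for an abelian divisor `Y ⊂ X` and an ample `Θ`** (`c₁(Θ) = -η₀`, `η₀` a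
Riemann form; `n - 1 = d = dim Y`): the degree `∫_X c₁(Θ)^{∧d} ∧ [Y] = ((Θ|_Y)^d)` of the abelian subvariety `Y` is
positive (p36's `SubtorusFrame.degree_pos_of_isRiemannForm`, de Jong's Nakai criterion 4.3.1 on `Y`).
[cite: Auffarth2015EllipticCurvesAbelianVarieties, §2 "deg D := (D · Θ^{n-1})" (p0006 L13) and Thm. 2.10] [cite: deJong1993AmpleLineBundles, Ch. VII §4 Thm. 4.3.1] -/
theorem cycleForm_ofSubspace_degree_pos {η₀ : E [⋀^Fin 2]→L[ℝ] ℝ} (hη₀ : IsRiemannForm Φ η₀) :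
    0 < torusIntegral Φ e ((wedgePow (ofRealForm (-η₀)) d).wedge
      ((SubtorusFrame.ofSubspace Φ W hW hWc eY hpos).cycleForm e)) :=
  (SubtorusFrame.ofSubspace Φ W hW hWc eY hpos).degree_pos_of_isRiemannForm Φ W hW hWc
    (SubtorusFrame.realSpan_ofSubspace Φ W hW hWc eY hpos) e hη₀

/-- `deg [Y] > 0`, read on the real part (the degree is a real number). [cite: Auffarth2015EllipticCurvesAbelianVarieties, §2 Thm. 2.10] -/
theorem cycleForm_ofSubspace_degree_re_pos {η₀ : E [⋀^Fin 2]→L[ℝ] ℝ} (hη₀ : IsRiemannForm Φ η₀) :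
    0 < (torusIntegral Φ e ((wedgePow (ofRealForm (-η₀)) d).wedge
      ((SubtorusFrame.ofSubspace Φ W hW hWc eY hpos).cycleForm e))).re := by
  have h := cycleForm_ofSubspace_degree_pos Φ W hW hWc eY hpos e hη₀
  rw [Complex.lt_def] at h
  simpa using h.1

/-- The degree is real: `Im deg [Y] = 0`. [cite: Auffarth2015EllipticCurvesAbelianVarieties, §2 "deg D" (p0006 L13)] -/
theorem cycleForm_ofSubspace_degree_im {η₀ : E [⋀^Fin 2]→L[ℝ] ℝ} (hη₀ : IsRiemannForm Φ η₀) :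
    (torusIntegral Φ e ((wedgePow (ofRealForm (-η₀)) d).wedge
      ((SubtorusFrame.ofSubspace Φ W hW hWc eY hpos).cycleForm e))).im = 0 := by
  have h := cycleForm_ofSubspace_degree_pos Φ W hW hWc eY hpos e hη₀
  rw [Complex.lt_def] at h
  simpa using h.2.symm

/-- **`deg [Y] = d! · m` with an integer `m ≥ 1`** (`m = χ(Θ|_Y) = h⁰(Θ|_Y)`; Riemann–Roch on the abelian subvariety
`Y`, p36's `SubtorusFrame.exists_pos_degree_eq_factorial_mul`). [cite: deJong1993AmpleLineBundles, Ch. VII §4 Remarks 4.3 (a)(e) and Thm. 4.3.1] [cite: Auffarth2015EllipticCurvesAbelianVarieties, §3 Lemma 3.4 (proof: "`deg Z = ((Θ|_Z)^{n-1}) = (n-1)! χ(Θ|_Z)`")] -/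
theorem cycleForm_ofSubspace_exists_pos_degree_eq_factorial_mul {η₀ : E [⋀^Fin 2]→L[ℝ] ℝ}
    (hη₀ : IsRiemannForm Φ η₀) :
    ∃ m : ℕ, 0 < m ∧ torusIntegral Φ e ((wedgePow (ofRealForm (-η₀)) d).wedge
      ((SubtorusFrame.ofSubspace Φ W hW hWc eY hpos).cycleForm e)) = (d.factorial : ℂ) * m :=
  (SubtorusFrame.ofSubspace Φ W hW hWc eY hpos).exists_pos_degree_eq_factorial_mul Φ W hW hWc
    (SubtorusFrame.realSpan_ofSubspace Φ W hW hWc eY hpos) e hη₀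

/-- **`deg (-[Y]) < 0`**: the opposite class has negative degree — the sign that Theorem 2.10 uses to single out `[Y]`
among `±[Y]`. [cite: Auffarth2015EllipticCurvesAbelianVarieties, §2 Thm. 2.10 (proof)] -/
theorem torusIntegral_wedgePow_wedge_neg_cycleForm_re_neg {η₀ : E [⋀^Fin 2]→L[ℝ] ℝ} (hη₀ : IsRiemannForm Φ η₀) :
    (torusIntegral Φ e ((wedgePow (ofRealForm (-η₀)) d).wedge
      (-(SubtorusFrame.ofSubspace Φ W hW hWc eY hpos).cycleForm e))).re < 0 := by
  rw [wedge_neg_right', torusIntegral_neg'', Complex.neg_re, neg_lt_zero]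
  exact cycleForm_ofSubspace_degree_re_pos Φ W hW hWc eY hpos e hη₀

end Degree

/-! ## §2 Theorem 2.10 / 1.1: surjectivity on the nose, every dimension -/

section Surjective

variable {ι : Type*} [Fintype ι] [DecidableEq ι] {E : Type*} [NormedAddCommGroup E] [NormedSpace ℂ E]
  (Φ : (ι → ℝ) ≃L[ℝ] E) [FiniteDimensional ℂ E] {d : ℕ}

/-- **Theorem 2.10 / 1.1 (surjectivity), every dimension `n = d + 1`: a PRIMITIVE class `γ ∈ H²(X, ℤ) ∩ H^{1,1}(X)`
with `γ ∧ γ = 0` and `deg γ = (γ · Θ^{n-1}) > 0` is the class `[Y]` of an abelian divisor `Y ⊂ X`** (namely of the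
radical torus `K(L)⁰` of `γ`). FILE 3 (`exists_cycleForm_of_primitive_of_wedge_self_eq_zero'`) gives `γ = ±[Y]`; the sign
is fixed by §1, `deg(-[Y]) < 0 < deg γ`. [cite: Auffarth2015EllipticCurvesAbelianVarieties, §2 Thm. 2.10 (p0006 L21–L24) and §1 Thm. 1.1 (p0003 L21–L22)] [cite: Kani1994EllipticCurvesAbelianSurfaces, (surfaces)] -/
theorem exists_cycleForm_eq_of_primitive_of_wedge_self_eq_zero_of_degree_pos (e : Fin (2 * d + 2) ≃ ι)
    {η₀ : E [⋀^Fin 2]→L[ℝ] ℝ} (hη₀ : IsRiemannForm Φ η₀) {γ : E [⋀^Fin 2]→L[ℝ] ℂ}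
    (hγ : γ ∈ integralHodgeClasses Φ 1)
    (hprim : ∀ (k : ℤ) (β : E [⋀^Fin 2]→L[ℝ] ℂ), β ∈ integralForms Φ 2 → (k : ℂ) • β = γ → k = 1 ∨ k = -1)
    (hγγ : γ.wedge γ = 0) (hdeg : 0 < (torusIntegral Φ e ((wedgePow (ofRealForm (-η₀)) d).wedge γ)).re) :
    ∃ (W : Submodule ℝ (ι → ℝ)) (hW : IsLatticeSubspace W) (hWc : IsComplexSubspace Φ W)
      (eY : Fin (2 * d) ≃ Fin (subRank W)) (hpos : orientationSign (subtorusPeriod Φ W hW hWc) eY = 1),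
      W ≠ ⊤ ∧ γ = (SubtorusFrame.ofSubspace Φ W hW hWc eY hpos).cycleForm e := by
  obtain ⟨W, hW, hWc, eY, hpos, hWt, h⟩ :=
    exists_cycleForm_of_primitive_of_wedge_self_eq_zero' Φ e hγ hprim hγγ
  refine ⟨W, hW, hWc, eY, hpos, hWt, ?_⟩
  rcases h with h | h
  · exact h
  · exfalso
    have hneg := torusIntegral_wedgePow_wedge_neg_cycleForm_re_neg Φ W hW hWc eY hpos e hη₀
    rw [← h] at hneg
    exact lt_asymm hdeg hneg

/-- The same with the degree hypothesis in the ordered field `ℂ` (`0 < deg γ`). [cite: Auffarth2015EllipticCurvesAbelianVarieties, §2 Thm. 2.10] -/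
theorem exists_cycleForm_eq_of_primitive_of_wedge_self_eq_zero_of_degree_pos' (e : Fin (2 * d + 2) ≃ ι)
    {η₀ : E [⋀^Fin 2]→L[ℝ] ℝ} (hη₀ : IsRiemannForm Φ η₀) {γ : E [⋀^Fin 2]→L[ℝ] ℂ}
    (hγ : γ ∈ integralHodgeClasses Φ 1)
    (hprim : ∀ (k : ℤ) (β : E [⋀^Fin 2]→L[ℝ] ℂ), β ∈ integralForms Φ 2 → (k : ℂ) • β = γ → k = 1 ∨ k = -1)
    (hγγ : γ.wedge γ = 0) (hdeg : 0 < torusIntegral Φ e ((wedgePow (ofRealForm (-η₀)) d).wedge γ)) :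
    ∃ (W : Submodule ℝ (ι → ℝ)) (hW : IsLatticeSubspace W) (hWc : IsComplexSubspace Φ W)
      (eY : Fin (2 * d) ≃ Fin (subRank W)) (hpos : orientationSign (subtorusPeriod Φ W hW hWc) eY = 1),
      W ≠ ⊤ ∧ γ = (SubtorusFrame.ofSubspace Φ W hW hWc eY hpos).cycleForm e := by
  refine exists_cycleForm_eq_of_primitive_of_wedge_self_eq_zero_of_degree_pos Φ e hη₀ hγ hprim hγγ ?_
  rw [Complex.lt_def] at hdeg
  simpa using hdeg.1

end Surjective

/-! ## §3 The bijective correspondence `Z ↦ [Z]` -/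

section Bijection

variable {ι : Type*} [Fintype ι] [DecidableEq ι] {E : Type*} [NormedAddCommGroup E] [NormedSpace ℂ E]
  (Φ : (ι → ℝ) ≃L[ℝ] E) (W : Submodule ℝ (ι → ℝ)) (hW : IsLatticeSubspace W) (hWc : IsComplexSubspace Φ W)
  {d : ℕ} (eY : Fin (2 * d) ≃ Fin (subRank W)) (hpos : orientationSign (subtorusPeriod Φ W hW hWc) eY = 1)
  (e : Fin (2 * d + 2) ≃ ι)

/-- **The class `[Y]` depends only on the abelian divisor `Y`**, not on the positively oriented enumeration of the
adapted basis of `Λ ∩ W` used to write it: both are `p^*vol_{X/Y}` (`SubtorusFrame.cycleForm_ofSubspace`).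
[cite: Auffarth2015EllipticCurvesAbelianVarieties, §1 "`[D]` will denote the algebraic equivalence class of `D`" (p0003)] [cite: Lange2023AbelianVarietiesComplex, §6.2.1 (p. 302)] -/
theorem cycleForm_ofSubspace_eq_of_orientationSign_eq_one (eY' : Fin (2 * d) ≃ Fin (subRank W))
    (hpos' : orientationSign (subtorusPeriod Φ W hW hWc) eY' = 1) :
    (SubtorusFrame.ofSubspace Φ W hW hWc eY hpos).cycleForm e =
      (SubtorusFrame.ofSubspace Φ W hW hWc eY' hpos').cycleForm e := by
  classical
  set e'' : Fin 2 ≃ QuotIndex W := (Fintype.equivFinOfCardEq (card_quotIndex_eq W eY e)).symm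
  rw [SubtorusFrame.cycleForm_ofSubspace Φ W hW hWc eY hpos e e'',
    SubtorusFrame.cycleForm_ofSubspace Φ W hW hWc eY' hpos' e e'']

/-- **`Z ↦ [Z]` lands in the printed set**: for every abelian divisor `Y ⊂ X` and every ample `Θ`, the class `[Y]` is an
integral Hodge class (`∈ H²(X, ℤ) ∩ H^{1,1}`, i.e. in `NS(X)` by the integral Lefschetz `(1,1)` theorem of row A4-23),
PRIMITIVE (Lemma 2.7, FILE 1), of square zero `[Y] ∧ [Y] = 0` (Prop. 2.1, p36) and of positive degree
`([Y] · Θ^{n-1}) > 0` (§1). [cite: Auffarth2015EllipticCurvesAbelianVarieties, §2 Prop. 2.1, Lemma 2.7 and Thm. 2.10] -/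
theorem cycleForm_ofSubspace_mem_primitive_wedge_degree {η₀ : E [⋀^Fin 2]→L[ℝ] ℝ} (hη₀ : IsRiemannForm Φ η₀) :
    (SubtorusFrame.ofSubspace Φ W hW hWc eY hpos).cycleForm e ∈ integralHodgeClasses Φ 1 ∧
      (∀ (k : ℤ) (β : E [⋀^Fin 2]→L[ℝ] ℂ), β ∈ integralForms Φ 2 →
        (k : ℂ) • β = (SubtorusFrame.ofSubspace Φ W hW hWc eY hpos).cycleForm e → k = 1 ∨ k = -1) ∧
      ((SubtorusFrame.ofSubspace Φ W hW hWc eY hpos).cycleForm e).wedge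
          ((SubtorusFrame.ofSubspace Φ W hW hWc eY hpos).cycleForm e) = 0 ∧
      0 < (torusIntegral Φ e ((wedgePow (ofRealForm (-η₀)) d).wedge
        ((SubtorusFrame.ofSubspace Φ W hW hWc eY hpos).cycleForm e))).re := by
  set Z := SubtorusFrame.ofSubspace Φ W hW hWc eY hpos with hZ
  refine ⟨?_, fun k β hβ h ↦ ?_, ?_, ?_⟩
  · exact (mem_integralHodgeClasses_iff Φ).2
      ⟨Z.cycleForm_mem_integralForms e, ((mem_hodgeClasses_iff Φ).1 (Z.cycleForm_mem_hodgeClasses (p := 1) e)).2⟩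
  · exact cycleForm_ofSubspace_primitive Φ W hW hWc eY hpos e k hβ h
  · exact Z.cycleForm_wedge_self_eq_zero Φ e (by norm_num)
  · exact cycleForm_ofSubspace_degree_re_pos Φ W hW hWc eY hpos e hη₀

variable [FiniteDimensional ℂ E]

omit W hW hWc eY hpos in
/-- **Theorem 1.1 / 2.10 as a BIJECTIVE CORRESPONDENCE, every dimension `n = d + 1`**: for a primitive integral Hodge
class `γ ∈ H²(X, ℤ) ∩ H^{1,1}(X)` with `γ ∧ γ = 0` and `(γ · Θ^{n-1}) > 0` there is EXACTLY ONE abelian divisor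
`Y = π(ΦW)` with `[Y] = γ` (existence: §2; uniqueness: FILE 1); together with
`cycleForm_ofSubspace_mem_primitive_wedge_degree` (every `[Y]` is such a class) this is the printed bijection
`Z ↦ [Z]`. [cite: Auffarth2015EllipticCurvesAbelianVarieties, §1 Thm. 1.1 (p0003 L21–L22) and §2 Thm. 2.10 (p0006 L21–L24)] [cite: Kani1994EllipticCurvesAbelianSurfaces, (surfaces)] -/
theorem existsUnique_abelianDivisor_of_primitive_of_wedge_self_eq_zero_of_degree_pos
    {η₀ : E [⋀^Fin 2]→L[ℝ] ℝ} (hη₀ : IsRiemannForm Φ η₀) {γ : E [⋀^Fin 2]→L[ℝ] ℂ}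
    (hγ : γ ∈ integralHodgeClasses Φ 1)
    (hprim : ∀ (k : ℤ) (β : E [⋀^Fin 2]→L[ℝ] ℂ), β ∈ integralForms Φ 2 → (k : ℂ) • β = γ → k = 1 ∨ k = -1)
    (hγγ : γ.wedge γ = 0) (hdeg : 0 < (torusIntegral Φ e ((wedgePow (ofRealForm (-η₀)) d).wedge γ)).re) :
    ∃! W : Submodule ℝ (ι → ℝ), ∃ (hW : IsLatticeSubspace W) (hWc : IsComplexSubspace Φ W)
      (eY : Fin (2 * d) ≃ Fin (subRank W)) (hpos : orientationSign (subtorusPeriod Φ W hW hWc) eY = 1),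
      γ = (SubtorusFrame.ofSubspace Φ W hW hWc eY hpos).cycleForm e := by
  obtain ⟨W, hW, hWc, eY, hpos, -, h⟩ :=
    exists_cycleForm_eq_of_primitive_of_wedge_self_eq_zero_of_degree_pos Φ e hη₀ hγ hprim hγγ hdeg
  refine ⟨W, ⟨hW, hWc, eY, hpos, h⟩, ?_⟩
  rintro W' ⟨hW', hWc', eY', hpos', h'⟩
  exact (eq_of_cycleForm_ofSubspace_eq Φ W hW hWc eY hpos e hW' hWc' eY' hpos' (h.symm.trans h')).symm

omit W hW hWc eY hpos in
/-- **The abelian divisor of Theorem 2.10 is a proper subtorus of the expected rank**: `W ≠ Λ ⊗ ℝ` and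
`rk(Λ ∩ W) = 2d = 2(n-1)` (so `Y ≠ X`, `dim Y = n - 1`; for `n ≥ 2` also `Y ≠ 0`).
[cite: Auffarth2015EllipticCurvesAbelianVarieties, §1 "An abelian divisor will be an abelian subvariety of `A` of codimension 1" (p0002)] -/
theorem exists_abelianDivisor_subRank_eq_of_primitive_of_wedge_self_eq_zero_of_degree_pos
    {η₀ : E [⋀^Fin 2]→L[ℝ] ℝ} (hη₀ : IsRiemannForm Φ η₀) {γ : E [⋀^Fin 2]→L[ℝ] ℂ}
    (hγ : γ ∈ integralHodgeClasses Φ 1)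
    (hprim : ∀ (k : ℤ) (β : E [⋀^Fin 2]→L[ℝ] ℂ), β ∈ integralForms Φ 2 → (k : ℂ) • β = γ → k = 1 ∨ k = -1)
    (hγγ : γ.wedge γ = 0) (hdeg : 0 < (torusIntegral Φ e ((wedgePow (ofRealForm (-η₀)) d).wedge γ)).re) :
    ∃ (W : Submodule ℝ (ι → ℝ)) (hW : IsLatticeSubspace W) (hWc : IsComplexSubspace Φ W)
      (eY : Fin (2 * d) ≃ Fin (subRank W)) (hpos : orientationSign (subtorusPeriod Φ W hW hWc) eY = 1),
      W ≠ ⊤ ∧ subRank W = 2 * d ∧ γ = (SubtorusFrame.ofSubspace Φ W hW hWc eY hpos).cycleForm e := by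
  obtain ⟨W, hW, hWc, eY, hpos, hWt, h⟩ :=
    exists_cycleForm_eq_of_primitive_of_wedge_self_eq_zero_of_degree_pos Φ e hη₀ hγ hprim hγγ hdeg
  exact ⟨W, hW, hWc, eY, hpos, hWt, by simpa using (Fintype.card_congr eY).symm, h⟩

end Bijection

end ComplexTorus

end Literature.Geometry.Kaehler

end
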